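import Literature.LinearAlgebra.Matrix.IntegralUnitaryFrameOfIdempotents
import Literature.LinearAlgebra.Matrix.IntegralConjugacyOfIdempotents
import Mathlib.Tactic.Module
import Mathlib.Tactic.LinearCombination
import HarnessLib

/-!
# Integral UNITARY conjugacy of split semisimple elements, and Kottwitz's orbit lemma for `U(J)` at a SINGULAR semisimple
# element (Kottwitz, *Stable trace formula: elliptic singular terms* (1986), Prop. 7.1 ∕ Cor. 7.3; Rogawski (1990), §3.3 p. 21)

Topic `LinearAlgebra/Matrix`; namespace `Literature.LinearAlgebra.Matrix`; THEOREMS ONLY (no definition, no instance, no named fact,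
no `sorry`), over ★ `IntegralUnitaryFrameOfIdempotents` (the adapted orthonormal frame of a self-adjoint idempotent and `hnorm` on its
commutant) and ★ `IntegralUnitaryConjugacyOfRegularElements` (`exists_integral_unitary_conj_of_conj`, the upgrade of a `GL_m`
conjugator to a unitary one MODULO `hnorm`).

SETTING.  `𝒪` a LOCAL commutative ring with involution `σ` satisfying Jacobowitz's (trace) and (norm) (the valuation ring of an
unramified quadratic extension of non-archimedean local fields: ★ `UnramifiedQuadraticNorm.exists_mul_map_eq_of_finite_residueField`,
★ `HermitianFormsHensel.exists_add_map_eq_one_of_isUnit_sub`), `J ∈ M_m(𝒪)` `σ`-hermitian unimodular, `τ X = J⁻¹ ᵗ(σX) J`.  A SPLIT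
SEMISIMPLE UNITARY element is a `J`-unitary `γ ∈ M_m(𝒪)` with `(γ − a)(γ − b) = 0`, `a − b ∈ 𝒪ˣ`, `a σ(a) = b σ(b) = 1` — at almost
every place of a CM field this is the local shape of a rational singular semisimple element of the definite unitary group `U(H)`,
eigenvalues `a` (multiplicity `r`) and `b`.

* §1 `hermAdjoint_lagrange_idem_eq` — the Lagrange idempotent `e = (a − b)⁻¹ (γ − b)` is `τ`-SELF-ADJOINT (`τ γ = γ⁻¹ =
  σ(a)σ(b)((a + b) − γ)`): the two eigen-summands are `J`-orthogonal; **`exists_commute_hermAdjoint_mul_eq_of_mul_sub_eq_zero`** —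
  `hnorm` on the commutant of `γ` (= the commutant of `e`; ★ `exists_commute_hermAdjoint_mul_eq_of_isIdempotentElem`).
* §2 the two consumer shapes of the regular file with «`p_γ` separable mod `𝔪`» replaced by the split-semisimple binders and the
  `GL_m(𝒪)` conjugator `k₀` taken as INPUT (it is produced by the idempotent calculus `IntegralConjugacyOfIdempotents`):
  **`exists_integral_unitary_conj_of_mul_sub_eq_zero`** (`γ′ k = k γ` with `k` unitary integral) and the ORBIT form along an
  injective `f : 𝒪 →+* F` intertwining the involutions, **`exists_integral_unitary_map_mul_of_conj_of_mul_sub_eq_zero`**: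
  `y ∈ U(J)(F)` with `y (γ ⊗ 1) = (g′ ⊗ 1) y`, `g′` integral and `GL_m(𝒪)`-conjugate to `γ` ⇒ `y = (k ⊗ 1) z`, `k ∈ U(J)(𝒪)`,
  `z ∈ U(J)(F)_{γ ⊗ 1}` — «`{y ∣ y γ y⁻¹ ∈ K} = K · U(J)(F)_γ`», the one-place text of the singular `K_v`-conjugacy.

NOT here: the `Subgroup` dress over ★ `unitaryGroupOfForm` ∕ ★ `glInt`, the split places (pure `GL_m`), and the a.e. assembly over a CM
field (`NumberTheory/Rogawski1990`).

## References
* R. E. Kottwitz, *Stable trace formula: elliptic singular terms*, Math. Ann. 275 (1986), §7 Prop. 7.1, Cor. 7.3 [Kottwitz1986].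
* J. D. Rogawski, *Automorphic Representations of Unitary Groups in Three Variables*, Ann. of Math. Stud. 123 (1990), §3.3 p. 21
  [Rogawski1990].
* R. Jacobowitz, *Hermitian forms over local fields*, Amer. J. Math. 84 (1962), §2, §7 Thm. 7.1 [Jacobowitz1962].
-/

set_option autoImplicit false

open Matrix

namespace Literature.LinearAlgebra.Matrix

/-! ## §1 Split semisimple unitary elements with two unit-separated unitary eigenvalues -/

section Split

variable {A : Type*} [CommRing A] (σ : A →+* A) {m : ℕ}

/-- The Lagrange idempotent of an element killed by `(X − a)(X − b)` with `a − b` a unit: `e = (a − b)⁻¹ (γ − b)` satisfies `e² = e`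
(private copy of the `GL` statement; the public idempotent calculus is A-p01's ★-to-be `IntegralConjugacyOfIdempotents`).
[cite: Kottwitz1986, §7 Prop. 7.1] -/
private theorem lagrange_idem_mul_self {γ : Matrix (Fin m) (Fin m) A} {a b u : A} (hu : u * (a - b) = 1)
    (hγ : (γ - a • (1 : Matrix (Fin m) (Fin m) A)) * (γ - b • (1 : Matrix (Fin m) (Fin m) A)) = 0) :
    (u • (γ - b • (1 : Matrix (Fin m) (Fin m) A))) * (u • (γ - b • (1 : Matrix (Fin m) (Fin m) A))) =
      u • (γ - b • (1 : Matrix (Fin m) (Fin m) A)) := by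
  have hcomm : (γ - b • (1 : Matrix (Fin m) (Fin m) A)) * (γ - a • 1) = (γ - a • 1) * (γ - b • 1) := by
    simp only [sub_mul, mul_sub, Matrix.smul_mul, Matrix.mul_smul, Matrix.one_mul, Matrix.mul_one, smul_smul, mul_comm a b]
    abel
  have h2 : γ - a • (1 : Matrix (Fin m) (Fin m) A) = (γ - b • 1) - (a - b) • 1 := by
    rw [sub_smul]; abel
  have hsq : (γ - b • (1 : Matrix (Fin m) (Fin m) A)) * (γ - b • 1) = (a - b) • (γ - b • 1) := by
    have h3 : (γ - b • (1 : Matrix (Fin m) (Fin m) A)) * (γ - b • 1) - (a - b) • (γ - b • 1) = 0 := by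
      calc (γ - b • (1 : Matrix (Fin m) (Fin m) A)) * (γ - b • 1) - (a - b) • (γ - b • 1)
            = (γ - b • 1) * ((γ - b • 1) - (a - b) • 1) := by
              conv_rhs => rw [Matrix.mul_sub, Matrix.mul_smul, Matrix.mul_one]
        _ = 0 := by rw [← h2, hcomm, hγ]
    exact sub_eq_zero.1 h3
  rw [Matrix.smul_mul, Matrix.mul_smul, hsq, smul_smul, smul_smul, mul_assoc, hu, mul_one]

/-- **The Lagrange idempotent of a split semisimple UNITARY element is self-adjoint.**  If `γ` is `J`-unitary (`ᵗ(σγ) J γ = J`,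
`J` invertible) with `(γ − a)(γ − b) = 0`, where `a σ(a) = 1 = b σ(b)` and `u (a − b) = 1`, then `e = u (γ − b)` satisfies
`τ e = e` for `τ X = J⁻¹ ᵗ(σX) J` — the two eigen-summands of `γ` are `J`-ORTHOGONAL (`τ γ = γ⁻¹ = σ(a)σ(b)((a + b) − γ)`).
[cite: Kottwitz1986, §7 Prop. 7.1] [cite: Jacobowitz1962, §2] -/
theorem hermAdjoint_lagrange_idem_eq {J : Matrix (Fin m) (Fin m) A} (hJdet : IsUnit J.det)
    {γ : Matrix (Fin m) (Fin m) A} {a b u : A} (hu : u * (a - b) = 1) (ha : a * σ a = 1) (hb : b * σ b = 1)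
    (hγ : (γ - a • (1 : Matrix (Fin m) (Fin m) A)) * (γ - b • (1 : Matrix (Fin m) (Fin m) A)) = 0)
    (hγU : (γ.map σ)ᵀ * J * γ = J) :
    J⁻¹ * ((u • (γ - b • (1 : Matrix (Fin m) (Fin m) A))).map σ)ᵀ * J = u • (γ - b • (1 : Matrix (Fin m) (Fin m) A)) := by
  -- scalar identities
  have h4 : σ u * (σ a - σ b) = 1 := by simpa using congrArg σ hu
  have s1 : σ u * (b - a) = a * b := by linear_combination (a * b) * h4 - (σ u * b) * ha + (σ u * a) * hb
  have key : -(σ u * σ b) = u * a := by linear_combination (σ u * σ b) * hu + (u * σ b) * s1 + (u * a) * hb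
  have key' : σ u * σ a * σ b = -u := by
    linear_combination (-(σ a)) * key - u * ha
  -- `γ² = (a + b) γ − ab`
  have hsq : γ * γ = (a + b) • γ - (a * b) • (1 : Matrix (Fin m) (Fin m) A) := by
    have h : γ * γ - (a + b) • γ + (a * b) • (1 : Matrix (Fin m) (Fin m) A) = 0 := by
      rw [← hγ]
      simp only [sub_mul, mul_sub, Matrix.smul_mul, Matrix.mul_smul, Matrix.one_mul, Matrix.mul_one, smul_smul, add_smul,
        mul_comm b a]
      abel
    rw [← sub_eq_zero]
    rw [← h]
    abel
  -- `γ⁻¹ = σ(a)σ(b) ((a + b) − γ)` and `τ γ = γ⁻¹`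
  have hinv : (σ a * σ b) • ((a + b) • (1 : Matrix (Fin m) (Fin m) A) - γ) * γ = 1 := by
    rw [Matrix.smul_mul, sub_mul, Matrix.smul_mul, Matrix.one_mul, hsq, sub_sub_cancel, smul_smul]
    have h1 : σ a * σ b * (a * b) = 1 := by linear_combination (σ b * b) * ha + hb
    rw [h1, one_smul]
  have hτγ : J⁻¹ * (γ.map σ)ᵀ * J = (σ a * σ b) • ((a + b) • (1 : Matrix (Fin m) (Fin m) A) - γ) := by
    have h1 : J⁻¹ * (γ.map σ)ᵀ * J * γ = 1 := (hermAdjoint_mul_self_eq_one_iff σ hJdet γ).2 hγU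
    rw [← Matrix.inv_eq_left_inv h1, Matrix.inv_eq_left_inv hinv]
  -- expand `τ e` and compare coefficients of `γ` and `1`
  rw [hermAdjoint_smul, sub_eq_add_neg, hermAdjoint_add, hτγ, ← neg_smul, hermAdjoint_smul, hermAdjoint_one σ hJdet, map_neg]
  match_scalars
  · linear_combination (a + b) * key' + key
  · linear_combination -key'

variable [IsLocalRing A]

/-- **`hnorm` FOR A SPLIT SEMISIMPLE UNITARY ELEMENT.**  Over a local ring with involution satisfying (trace) and (norm): for `J`
`σ`-hermitian unimodular and `γ` `J`-unitary with `(γ − a)(γ − b) = 0`, `a − b ∈ 𝒪ˣ`, `a σ(a) = b σ(b) = 1` (a semisimple element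
with the two UNITARY eigenvalues `a, b`, separated by a unit), every `τ`-fixed invertible `b′` commuting with `γ` is `τ(c) c` for some
`c` commuting with `γ` — the `hnorm` binder of ★ `exists_integral_unitary_conj_of_conj` at such a `γ` (the commutant of `γ` is that of
its Lagrange idempotent; `exists_commute_hermAdjoint_mul_eq_of_isIdempotentElem`). [cite: Kottwitz1986, §7 Prop. 7.1]
[cite: Rogawski1990, §3.3 p. 21] -/
theorem exists_commute_hermAdjoint_mul_eq_of_mul_sub_eq_zero (hσ : ∀ x, σ (σ x) = x) (htr : ∃ t : A, t + σ t = 1)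
    (hnorm : ∀ v : A, IsUnit v → σ v = v → ∃ t : A, t * σ t = v)
    {J : Matrix (Fin m) (Fin m) A} (hJ : (J.map σ)ᵀ = J) (hJdet : IsUnit J.det)
    {γ : Matrix (Fin m) (Fin m) A} {a b : A} (hab : IsUnit (a - b)) (ha : a * σ a = 1) (hb : b * σ b = 1)
    (hγ : (γ - a • (1 : Matrix (Fin m) (Fin m) A)) * (γ - b • (1 : Matrix (Fin m) (Fin m) A)) = 0)
    (hγU : (γ.map σ)ᵀ * J * γ = J) :
    ∀ b' : Matrix (Fin m) (Fin m) A, Commute γ b' → IsUnit b'.det → J⁻¹ * (b'.map σ)ᵀ * J = b' →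
      ∃ c : Matrix (Fin m) (Fin m) A, Commute γ c ∧ J⁻¹ * (c.map σ)ᵀ * J * c = b' := by
  obtain ⟨u, hu⟩ := hab.exists_left_inv
  intro b' hγb' hb' hτb'
  have he := lagrange_idem_mul_self (m := m) hu hγ
  have hτe := hermAdjoint_lagrange_idem_eq σ hJdet hu ha hb hγ hγU
  have hγe : γ = (a - b) • (u • (γ - b • (1 : Matrix (Fin m) (Fin m) A))) + b • (1 : Matrix (Fin m) (Fin m) A) := by
    rw [smul_smul, mul_comm, hu, one_smul, sub_add_cancel]
  have heb' : Commute (u • (γ - b • (1 : Matrix (Fin m) (Fin m) A))) b' :=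
    (hγb'.sub_left ((Commute.one_left b').smul_left b)).smul_left u
  obtain ⟨c, hec, hc⟩ :=
    exists_commute_hermAdjoint_mul_eq_of_isIdempotentElem σ hσ htr hnorm hJ hJdet he hτe b' heb' hb' hτb'
  refine ⟨c, ?_, hc⟩
  rw [hγe]
  exact (hec.smul_left (a - b)).add_left ((Commute.one_left c).smul_left b)

end Split

/-! ## §2 The two consumer shapes: integral unitary conjugacy, and Kottwitz's orbit lemma at a split semisimple element -/

section Consumers

variable {𝒪 F : Type*} [CommRing 𝒪] [IsLocalRing 𝒪] [CommRing F] {m : ℕ}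

/-- **Integral UNITARY conjugacy of split semisimple unitary elements** (Kottwitz's Prop. 7.1 for `U(J)` at a SINGULAR semisimple
point, two integral points).  `𝒪` local with involution `σ` satisfying (trace) and (norm), `J` `σ`-hermitian unimodular; `γ, γ′`
`J`-unitary, `γ` killed by `(X − a)(X − b)` with `a − b ∈ 𝒪ˣ` and `a σ(a) = b σ(b) = 1`; IF `γ′ k₀ = k₀ γ` for some `k₀ ∈ GL_m(𝒪)` (the
`GL_m` conjugator — output of the idempotent calculus `IntegralConjugacyOfIdempotents`), THEN `γ′ k = k γ` for a `J`-UNITARY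
`k ∈ GL_m(𝒪)` with `k₀⁻¹ k` in the commutant of `γ` (★ `exists_integral_unitary_conj_of_conj` with `hnorm` discharged by
`exists_commute_hermAdjoint_mul_eq_of_mul_sub_eq_zero`). [cite: Kottwitz1986, §7 Prop. 7.1] [cite: Rogawski1990, §3.3 p. 21] -/
theorem exists_integral_unitary_conj_of_mul_sub_eq_zero (σ : 𝒪 →+* 𝒪) (hσ : ∀ x, σ (σ x) = x) (htr : ∃ t : 𝒪, t + σ t = 1)
    (hnorm : ∀ v : 𝒪, IsUnit v → σ v = v → ∃ t : 𝒪, t * σ t = v)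
    {J : Matrix (Fin m) (Fin m) 𝒪} (hJ : (J.map σ)ᵀ = J) (hJdet : IsUnit J.det)
    {γ γ' k₀ : Matrix (Fin m) (Fin m) 𝒪} {a b : 𝒪} (hab : IsUnit (a - b)) (ha : a * σ a = 1) (hb : b * σ b = 1)
    (hγ : (γ - a • (1 : Matrix (Fin m) (Fin m) 𝒪)) * (γ - b • (1 : Matrix (Fin m) (Fin m) 𝒪)) = 0)
    (hγU : (γ.map σ)ᵀ * J * γ = J) (hγ'U : (γ'.map σ)ᵀ * J * γ' = J) (hk₀ : IsUnit k₀.det) (h : γ' * k₀ = k₀ * γ) :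
    ∃ k : Matrix (Fin m) (Fin m) 𝒪, IsUnit k.det ∧ (k.map σ)ᵀ * J * k = J ∧ γ' * k = k * γ ∧ Commute γ (k₀⁻¹ * k) :=
  exists_integral_unitary_conj_of_conj σ hσ hJ hJdet hk₀ hγU hγ'U h
    (exists_commute_hermAdjoint_mul_eq_of_mul_sub_eq_zero σ hσ htr hnorm hJ hJdet hab ha hb hγ hγU)

/-- **Kottwitz's orbit lemma for `U(J)` with `K = U(J)(F) ∩ GL_m(𝒪)` at a SPLIT SEMISIMPLE element** — the one-place text of the
singular `K_v`-conjugacy.  `f : 𝒪 →+* F` injective from a local ring with (trace) and (norm), intertwining the involutions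
`σ_𝒪, σ_F`; `J ∈ GL_m(𝒪)` `σ_𝒪`-hermitian; `γ ∈ M_m(𝒪)` `J`-unitary with `(γ − a)(γ − b) = 0`, `a − b ∈ 𝒪ˣ`, `a σ(a) = b σ(b) = 1`;
`y ∈ GL_m(F)` `(σ_F, J ⊗ 1)`-unitary with `y (γ ⊗ 1) = (g′ ⊗ 1) y` for an integral `g′` which is `GL_m(𝒪)`-conjugate to `γ`
(`g′ k₀ = k₀ γ`, the `GL_m` input).  Then `y = (k ⊗ 1) · z` with `k ∈ GL_m(𝒪)` `J`-UNITARY and `z ∈ GL_m(F)` `J`-unitary commuting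
with `γ ⊗ 1`: «`{y ∈ U(J)(F) ∣ y γ y⁻¹ ∈ K} = K · U(J)(F)_γ`». [cite: Kottwitz1986, §7 Prop. 7.1, Cor. 7.3] [cite: Rogawski1990, §3.3 p. 21] -/
theorem exists_integral_unitary_map_mul_of_conj_of_mul_sub_eq_zero (f : 𝒪 →+* F) (hf : Function.Injective f)
    {σ𝒪 : 𝒪 →+* 𝒪} {σF : F →+* F} (hfσ : ∀ x, f (σ𝒪 x) = σF (f x)) (hσ : ∀ a, σ𝒪 (σ𝒪 a) = a)
    (htr : ∃ t : 𝒪, t + σ𝒪 t = 1) (hnorm : ∀ v : 𝒪, IsUnit v → σ𝒪 v = v → ∃ t : 𝒪, t * σ𝒪 t = v)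
    {J : Matrix (Fin m) (Fin m) 𝒪} (hJ : (J.map σ𝒪)ᵀ = J) (hJdet : IsUnit J.det)
    {γ g' k₀ : Matrix (Fin m) (Fin m) 𝒪} {a b : 𝒪} (hab : IsUnit (a - b)) (ha : a * σ𝒪 a = 1) (hb : b * σ𝒪 b = 1)
    (hγ : (γ - a • (1 : Matrix (Fin m) (Fin m) 𝒪)) * (γ - b • (1 : Matrix (Fin m) (Fin m) 𝒪)) = 0)
    (hγU : (γ.map σ𝒪)ᵀ * J * γ = J) (hk₀ : IsUnit k₀.det) (h₀ : g' * k₀ = k₀ * γ)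
    {y : Matrix (Fin m) (Fin m) F} (hy : IsUnit y.det) (hyU : (y.map σF)ᵀ * J.map f * y = J.map f)
    (h : y * γ.map f = g'.map f * y) :
    ∃ (k : Matrix (Fin m) (Fin m) 𝒪) (z : Matrix (Fin m) (Fin m) F), IsUnit k.det ∧ (k.map σ𝒪)ᵀ * J * k = J ∧
      IsUnit z.det ∧ z * γ.map f = γ.map f * z ∧ (z.map σF)ᵀ * J.map f * z = J.map f ∧ y = k.map f * z := by
  -- `g′ ⊗ 1 = y (γ ⊗ 1) y⁻¹` is unitary over `F`, hence `g′` is unitary over `𝒪`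
  have hg'f : g'.map f = y * γ.map f * y⁻¹ := by rw [h, Matrix.mul_nonsing_inv_cancel_right y _ hy]
  have hg'U : (g'.map σ𝒪)ᵀ * J * g' = J := by
    apply formUnitary_of_formUnitary_map f hf hfσ
    rw [hg'f]
    exact formUnitary_mul σF (formUnitary_mul σF hyU (formUnitary_map_of_formUnitary f hfσ hγU))
      (formUnitary_nonsing_inv σF hy hyU)
  -- upgrade the `GL_m` conjugator to a unitary one
  obtain ⟨k, hk, hkU, hkγ, -⟩ :=
    exists_integral_unitary_conj_of_mul_sub_eq_zero σ𝒪 hσ htr hnorm hJ hJdet hab ha hb hγ hγU hg'U hk₀ h₀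
  have hkf : IsUnit (k.map f).det := by rw [← RingHom.mapMatrix_apply, ← RingHom.map_det]; exact hk.map f
  have hkγf : g'.map f * k.map f = k.map f * γ.map f := by rw [← Matrix.map_mul, hkγ, Matrix.map_mul]
  refine ⟨k, (k.map f)⁻¹ * y, hk, hkU, ?_, ?_, ?_, ?_⟩
  · rw [Matrix.det_mul]; exact (Matrix.isUnit_nonsing_inv_det_iff.mpr hkf).mul hy
  · -- `z (γ ⊗ 1) = k⁻¹ (g′ ⊗ 1) y = k⁻¹ (g′ ⊗ 1) k · k⁻¹ y = (γ ⊗ 1) z`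
    calc (k.map f)⁻¹ * y * γ.map f = (k.map f)⁻¹ * (g'.map f * k.map f) * ((k.map f)⁻¹ * y) := by
          rw [Matrix.mul_assoc, h, Matrix.mul_assoc, Matrix.mul_assoc, Matrix.mul_nonsing_inv_cancel_left _ _ hkf]
      _ = γ.map f * ((k.map f)⁻¹ * y) := by rw [hkγf, Matrix.nonsing_inv_mul_cancel_left _ _ hkf]
  · exact formUnitary_mul σF (formUnitary_nonsing_inv σF hkf (formUnitary_map_of_formUnitary f hfσ hkU)) hyU
  · rw [Matrix.mul_nonsing_inv_cancel_left _ _ hkf]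

end Consumers

/-! ## §3 The orbit lemma with the `GL_m` conjugator supplied by the idempotent calculus (`𝒪` of characteristic zero) -/

section Closed

variable {𝒪 F : Type*} [CommRing 𝒪] [IsLocalRing 𝒪] [CharZero 𝒪] [CommRing F] {m : ℕ}

/-- **KOTTWITZ'S ORBIT LEMMA FOR `U(J)` AT A SPLIT SEMISIMPLE ELEMENT — closed form.**  `f : 𝒪 →+* F` injective from a LOCAL ring
of characteristic zero with involution `σ_𝒪` satisfying (trace) and (norm), intertwining `σ_𝒪, σ_F`; `J ∈ GL_m(𝒪)` `σ_𝒪`-hermitian;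
`γ ∈ M_m(𝒪)` `J`-unitary with `(γ − a)(γ − b) = 0`, `a − b ∈ 𝒪ˣ`, `a σ(a) = b σ(b) = 1`.  If `y ∈ GL_m(F)` is `(σ_F, J ⊗ 1)`-unitary and
`y (γ ⊗ 1) = (g′ ⊗ 1) y` with `g′` INTEGRAL, then `y = (k ⊗ 1) · z` with `k ∈ GL_m(𝒪)` `J`-unitary and `z` `J`-unitary in the
centraliser of `γ ⊗ 1`: «`y γ y⁻¹ ∈ K ⇒ y ∈ K · U(J)(F)_γ`» for `K = U(J)(F) ∩ GL_m(𝒪)` — the `GL_m(𝒪)` conjugator comes from ★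
`IntegralConjugacyOfIdempotents.exists_isUnit_det_mul_eq_mul_of_units_conj_map_eq` (ranks compared through the trace, whence
`CharZero`), the unitary upgrade from §2. [cite: Kottwitz1986, §7 Prop. 7.1, Cor. 7.3] [cite: Rogawski1990, §3.3 p. 21] -/
theorem exists_integral_unitary_map_mul_of_map_conj_of_mul_sub_eq_zero (f : 𝒪 →+* F) (hf : Function.Injective f)
    {σ𝒪 : 𝒪 →+* 𝒪} {σF : F →+* F} (hfσ : ∀ x, f (σ𝒪 x) = σF (f x)) (hσ : ∀ a, σ𝒪 (σ𝒪 a) = a)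
    (htr : ∃ t : 𝒪, t + σ𝒪 t = 1) (hnorm : ∀ v : 𝒪, IsUnit v → σ𝒪 v = v → ∃ t : 𝒪, t * σ𝒪 t = v)
    {J : Matrix (Fin m) (Fin m) 𝒪} (hJ : (J.map σ𝒪)ᵀ = J) (hJdet : IsUnit J.det)
    {γ g' : Matrix (Fin m) (Fin m) 𝒪} {a b : 𝒪} (hab : IsUnit (a - b)) (ha : a * σ𝒪 a = 1) (hb : b * σ𝒪 b = 1)
    (hγ : (γ - a • (1 : Matrix (Fin m) (Fin m) 𝒪)) * (γ - b • (1 : Matrix (Fin m) (Fin m) 𝒪)) = 0)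
    (hγU : (γ.map σ𝒪)ᵀ * J * γ = J)
    {y : Matrix (Fin m) (Fin m) F} (hy : IsUnit y.det) (hyU : (y.map σF)ᵀ * J.map f * y = J.map f)
    (h : y * γ.map f = g'.map f * y) :
    ∃ (k : Matrix (Fin m) (Fin m) 𝒪) (z : Matrix (Fin m) (Fin m) F), IsUnit k.det ∧ (k.map σ𝒪)ᵀ * J * k = J ∧
      IsUnit z.det ∧ z * γ.map f = γ.map f * z ∧ (z.map σF)ᵀ * J.map f * z = J.map f ∧ y = k.map f * z := by
  -- `g′ ⊗ 1 = y (γ ⊗ 1) y⁻¹` satisfies the same quadratic equation, hence so does `g′` (injectivity of `f`)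
  have hg'f : g'.map f = y * γ.map f * y⁻¹ := by rw [h, Matrix.mul_nonsing_inv_cancel_right y _ hy]
  have hone : (1 : Matrix (Fin m) (Fin m) 𝒪).map f = 1 := Matrix.map_one f (map_zero f) (map_one f)
  have hsmul : ∀ (c : 𝒪) (X : Matrix (Fin m) (Fin m) 𝒪), (c • X).map f = f c • X.map f := fun c X => by
    ext i j; simp only [Matrix.map_apply, Matrix.smul_apply, smul_eq_mul, map_mul]
  have hγ' : (g' - a • (1 : Matrix (Fin m) (Fin m) 𝒪)) * (g' - b • (1 : Matrix (Fin m) (Fin m) 𝒪)) = 0 := by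
    apply Matrix.map_injective hf
    change ((g' - a • (1 : Matrix (Fin m) (Fin m) 𝒪)) * (g' - b • 1)).map f = (0 : Matrix (Fin m) (Fin m) 𝒪).map f
    have hγf : (γ.map f - f a • (1 : Matrix (Fin m) (Fin m) F)) * (γ.map f - f b • 1) = 0 := by
      have h0 := congrArg (fun X : Matrix (Fin m) (Fin m) 𝒪 => X.map f) hγ
      simpa only [Matrix.map_mul, Matrix.map_sub _ (map_sub f), hsmul, hone, Matrix.map_zero f (map_zero f)] using h0
    rw [Matrix.map_mul, Matrix.map_sub _ (map_sub f), Matrix.map_sub _ (map_sub f), hsmul, hsmul, hone,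
      Matrix.map_zero f (map_zero f), hg'f]
    have h1 : y * γ.map f * y⁻¹ - f a • (1 : Matrix (Fin m) (Fin m) F) = y * (γ.map f - f a • 1) * y⁻¹ := by
      rw [Matrix.mul_sub, Matrix.sub_mul, Matrix.mul_smul, Matrix.mul_one, Matrix.smul_mul,
        Matrix.mul_nonsing_inv y hy]
    have h2 : y * γ.map f * y⁻¹ - f b • (1 : Matrix (Fin m) (Fin m) F) = y * (γ.map f - f b • 1) * y⁻¹ := by
      rw [Matrix.mul_sub, Matrix.sub_mul, Matrix.mul_smul, Matrix.mul_one, Matrix.smul_mul,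
        Matrix.mul_nonsing_inv y hy]
    rw [h1, h2]
    calc y * (γ.map f - f a • 1) * y⁻¹ * (y * (γ.map f - f b • 1) * y⁻¹)
          = y * ((γ.map f - f a • 1) * (y⁻¹ * y) * (γ.map f - f b • 1)) * y⁻¹ := by simp only [Matrix.mul_assoc]
      _ = 0 := by rw [Matrix.nonsing_inv_mul y hy, Matrix.mul_one, hγf, Matrix.mul_zero, Matrix.zero_mul]
  -- the `GL_m(𝒪)` conjugator from the idempotent calculus
  have hP : ((Matrix.nonsingInvUnit y hy : GL (Fin m) F) : Matrix (Fin m) (Fin m) F) * γ.map f *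
      (((Matrix.nonsingInvUnit y hy)⁻¹ : GL (Fin m) F) : Matrix (Fin m) (Fin m) F) = g'.map f := by
    rw [Matrix.coe_units_inv]
    change y * γ.map f * y⁻¹ = g'.map f
    rw [hg'f]
  obtain ⟨k₀, hk₀, h₀⟩ := exists_isUnit_det_mul_eq_mul_of_units_conj_map_eq f hf hab hγ hγ' _ hP
  exact exists_integral_unitary_map_mul_of_conj_of_mul_sub_eq_zero f hf hfσ hσ htr hnorm hJ hJdet hab ha hb hγ hγU hk₀ h₀
    hy hyU h

end Closed

end Literature.LinearAlgebra.Matrix
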